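import Summits.CriticalPhenomena.PercolationContinuityZ3.Theorems.PercNearOneGluingNoHeavyLowerTailSahiCombTriWAndMaj3

/-!
# AND with an OR₂ block: the sectionwise Formula-A score certifies `P₁ ∧ (x_a ∨ x_b)` for every intersecting Kleitman shell `P₁`

Support file of the one-cut programme (crux `NoHeavyLowerTail`, stmt-CriticalPhenomena-4575; unit `prim-lf-1` gen 43, memo
`FROM-prim-lf-1-gen43-AND-MAJ3.md` §4).  Continuation of `…SahiCombTriWAndProd` (gen 41): there the typed conjecture `AndShellLower` asks for the
LOWER sandwich bound of the sectionwise Formula-A score `secFAScore P₁ Q` on `andProd P₁ Q` (the upper bound `scoreVal_secFAScore_le_uForm` is proved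
for all up-sets).  Here the lower bound is PROVED for `Q = or2 = {y ⊆ Fin 2 | y ≠ ∅}` — the first case of `AndShellLower` with a NON-intersecting
second block (`S_Q = {{0},{1}} ≠ ∅`):
* **`lForm_le_scoreVal_andProd_or2`**: for every antipode-free up-set `P₁` with `Cor_{P₁} ≥ 0` on up-set pairs and all up-sets `A, B` of
  `2^{γ₁ ⊕ Fin 2}`: `L_{P₁ ∧ or2}(A,B) ≤ Σ_B secFAScore`.
* `scoreCert_andProd_or2`, **`triW_nonneg_andProd_or2`**: `TriWIneq` for `P₁ ∧ (x_a ∨ x_b)` on every index cube — e.g. `maj(234)·(x₀ ∨ x₁)`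
  (P5's n = 5 frontier class `(x₀∨x₁)·maj`), `cocover ∧ OR₂`, …; the stars `x_g(x_a ∨ x_b)` are the principal case.
Proof (row decomposition + an exact certificate).  Per row `x ∈ P₁`, with `u = [x⊔⊤∈A]−[xᶜ⊔⊥∈A]`, `d_i = [x⊔{i}∈A]−[xᶜ⊔{i}∈A]`,
`v_i = [x⊔{i}∈A]−[xᶜ⊔⊥∈A]`, `ū_i = [x⊔⊤∈A]−[xᶜ⊔{i}∈A]` (primes for `B`):
  `score − L = Σ_x [uu' + d₀d₁' + d₁d₀' + (ū₁−ū₀)(ū₁'−ū₀')]`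
  `= Σ_x [ū₁ū₁' + v₁d₀' + d₀v₁' + (u−v₀)(u'−ū₁') + (u−ū₀)(u'−ū₀') + (u−ū₁)(u'−v₀')]`;
`u, v_i, ū_i, d_i` are increasing `{−1,0,1}`-valued with the pair condition, so the first three products sum to `≥ 0` over `P₁` by
`sum_mul_nonneg_of_unit` (`…SahiCombTriWAndMaj3`), and the last three are pointwise `≥ 0`.
HONEST LABEL: complete proofs, std axioms; `AndShellLower` for `Q = or2` only (OR₃ has no certificate of this shape; the general conjecture stays OPEN). [this work]
-/

namespace Summit.CriticalPhenomena.PercolationContinuityZ3.Theorems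

namespace FiveUpSet

open Finset

variable {β γ₁ : Type} [DecidableEq β] [Fintype β] [DecidableEq γ₁] [Fintype γ₁]

/-! ### The family `or2` -/

/-- `or2 = {y ⊆ Fin 2 | y ≠ ∅} = {{0}, {1}, ⊤}`. [this work] -/
def or2 : Finset (Finset (Fin 2)) := univ.filter fun y => y.Nonempty

/-- The three elements of `or2`. [this work] -/
theorem or2_eq : or2 = {{0}, {1}, univ} := by decide

/-- `or2` is an up-set. [this work] -/
theorem isUpperSet_or2 : IsUpperSet (or2 : Set (Finset (Fin 2))) := by
  intro y y' hyy' hy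
  simp only [or2, coe_filter, mem_univ, true_and, Set.mem_setOf_eq] at hy ⊢
  exact hy.mono hyy'

/-- The symmetric core `or2 ∩ refl or2 = {{0},{1}}`. [this work] -/
theorem or2_inter_refl : or2 ∩ refl or2 = {{0}, {1}} := by decide

/-- The asymmetric part `or2 \ refl or2 = {⊤}`. [this work] -/
theorem or2_sdiff_refl : or2 \ refl or2 = {univ} := by decide

/-- `refl or2 = {∅, {0}, {1}}`. [this work] -/
theorem refl_or2 : refl or2 = {∅, {0}, {1}} := by decide

/-- Cardinality of the intersection of a singleton family with two families. [this work] -/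
theorem card_singleton_inter_inter {δ : Type} [DecidableEq δ] (s : Finset δ) (X Y : Finset (Finset δ)) :
    ((({s} : Finset (Finset δ)) ∩ X ∩ Y).card : ℤ) = ind X s * ind Y s := by
  rw [inter_assoc, ← filter_mem_eq_inter, filter_singleton]
  unfold ind
  by_cases hs : s ∈ X ∩ Y
  · rw [if_pos hs]; rw [mem_inter] at hs; simp [hs.1, hs.2]
  · rw [if_neg hs]; rw [mem_inter, not_and_or] at hs; rcases hs with h | h <;> simp [h]

/-- Cardinality of the intersection of a two-element family with two families. [this work] -/
theorem card_pair_inter_inter {δ : Type} [DecidableEq δ] {s t : Finset δ} (hst : s ≠ t) (X Y : Finset (Finset δ)) :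
    ((({s, t} : Finset (Finset δ)) ∩ X ∩ Y).card : ℤ) = ind X s * ind Y s + ind X t * ind Y t := by
  have hsplit : ({s, t} : Finset (Finset δ)) ∩ X ∩ Y = (({s} : Finset (Finset δ)) ∩ X ∩ Y) ∪ (({t} : Finset (Finset δ)) ∩ X ∩ Y) := by
    ext w; simp only [mem_inter, mem_union, mem_insert, mem_singleton]; tauto
  have hdisj : Disjoint (({s} : Finset (Finset δ)) ∩ X ∩ Y) (({t} : Finset (Finset δ)) ∩ X ∩ Y) := by
    rw [disjoint_left]; intro w h1 h2
    simp only [mem_inter, mem_singleton] at h1 h2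
    exact hst (h1.1.1.symm.trans h2.1.1)
  rw [hsplit, card_union_of_disjoint hdisj]; push_cast
  rw [card_singleton_inter_inter, card_singleton_inter_inter]

/-- Cardinality of the intersection of a three-element family with two families. [this work] -/
theorem card_triple_inter_inter {δ : Type} [DecidableEq δ] {r s t : Finset δ} (hrs : r ≠ s) (hrt : r ≠ t) (hst : s ≠ t) (X Y : Finset (Finset δ)) :
    ((({r, s, t} : Finset (Finset δ)) ∩ X ∩ Y).card : ℤ) = ind X r * ind Y r + ind X s * ind Y s + ind X t * ind Y t := by
  have hsplit : ({r, s, t} : Finset (Finset δ)) ∩ X ∩ Y = (({r} : Finset (Finset δ)) ∩ X ∩ Y) ∪ (({s, t} : Finset (Finset δ)) ∩ X ∩ Y) := by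
    ext w; simp only [mem_inter, mem_union, mem_insert, mem_singleton]; tauto
  have hdisj : Disjoint (({r} : Finset (Finset δ)) ∩ X ∩ Y) (({s, t} : Finset (Finset δ)) ∩ X ∩ Y) := by
    rw [disjoint_left]; intro w h1 h2
    simp only [mem_inter, mem_singleton, mem_insert] at h1 h2
    rcases h2.1.1 with h | h
    · exact hrs (h1.1.1.symm.trans h)
    · exact hrt (h1.1.1.symm.trans h)
  rw [hsplit, card_union_of_disjoint hdisj]; push_cast
  rw [card_singleton_inter_inter, card_pair_inter_inter hst]; ring

/-! ### Row atoms of a family on `2^{γ₁ ⊕ Fin 2}` -/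

omit [Fintype γ₁] in
/-- Indicator of a right section. [this work] -/
theorem ind_secR {δ : Type} [DecidableEq δ] [Fintype δ] (B : Finset (Finset (γ₁ ⊕ δ))) (x : Finset γ₁) (y : Finset δ) : ind (secR B x) y = ind B (x.disjSum y) := by
  unfold ind; simp only [mem_secR]

/-- `u_A(x) = [x⊔⊤ ∈ A] − [xᶜ⊔⊥ ∈ A]`. [this work] -/
def rU (A : Finset (Finset (γ₁ ⊕ Fin 2))) (x : Finset γ₁) : ℤ := ind A (x.disjSum univ) - ind A (xᶜ.disjSum ∅)

/-- `d_{A,i}(x) = [x⊔{i} ∈ A] − [xᶜ⊔{i} ∈ A]` (same second coordinate). [this work] -/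
def rD (A : Finset (Finset (γ₁ ⊕ Fin 2))) (i : Fin 2) (x : Finset γ₁) : ℤ := ind A (x.disjSum {i}) - ind A (xᶜ.disjSum {i})

/-- `v_{A,i}(x) = [x⊔{i} ∈ A] − [xᶜ⊔⊥ ∈ A]`. [this work] -/
def rV (A : Finset (Finset (γ₁ ⊕ Fin 2))) (i : Fin 2) (x : Finset γ₁) : ℤ := ind A (x.disjSum {i}) - ind A (xᶜ.disjSum ∅)

/-- `ū_{A,i}(x) = [x⊔⊤ ∈ A] − [xᶜ⊔{i} ∈ A]`. [this work] -/
def rW (A : Finset (Finset (γ₁ ⊕ Fin 2))) (i : Fin 2) (x : Finset γ₁) : ℤ := ind A (x.disjSum univ) - ind A (xᶜ.disjSum {i})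

section rowfacts
variable {A : Finset (Finset (γ₁ ⊕ Fin 2))} (hA : IsUpperSet (A : Set (Finset (γ₁ ⊕ Fin 2))))
include hA

/-- Generic unit-vector facts for `x ↦ [x⊔y ∈ A] − [xᶜ⊔y' ∈ A]` with `y' ⊆ y`: values in `[-1,1]`, increasing, pair condition. [this work] -/
theorem diffInd_facts {y y' : Finset (Fin 2)} (hyy : y' ⊆ y) :
    (∀ x : Finset γ₁, -1 ≤ ind A (x.disjSum y) - ind A (xᶜ.disjSum y') ∧ ind A (x.disjSum y) - ind A (xᶜ.disjSum y') ≤ 1) ∧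
    (∀ x x' : Finset γ₁, x ⊆ x' → ind A (x.disjSum y) - ind A (xᶜ.disjSum y') ≤ ind A (x'.disjSum y) - ind A (x'ᶜ.disjSum y')) ∧
    (∀ x x' : Finset γ₁, x ∪ x' = univ →
      0 ≤ (ind A (x.disjSum y) - ind A (xᶜ.disjSum y')) + (ind A (x'.disjSum y) - ind A (x'ᶜ.disjSum y'))) := by
  refine ⟨fun x => ?_, fun x x' h => ?_, fun x x' h => ?_⟩
  · have h1 := ind_nonneg_le_one A (x.disjSum y); have h2 := ind_nonneg_le_one A (xᶜ.disjSum y')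
    constructor <;> linarith
  · have h1 := ind_mono_pt hA (disjSum_mono h (le_refl y))
    have h2 := ind_mono_pt hA (disjSum_mono (compl_subset_compl.2 h) (le_refl y'))
    linarith
  · have hc : xᶜ ⊆ x' := by
      intro a ha; rw [mem_compl] at ha
      have := mem_univ a; rw [← h, mem_union] at this; tauto
    have hc' : x'ᶜ ⊆ x := by
      intro a ha; rw [mem_compl] at ha
      have := mem_univ a; rw [← h, mem_union] at this; tauto
    have h1 := ind_mono_pt hA (disjSum_mono hc hyy)
    have h2 := ind_mono_pt hA (disjSum_mono hc' hyy)
    linarith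

end rowfacts

/-- The row defect of the sectionwise Formula-A score on `P₁ ∧ or2` (per `x`, as an indicator polynomial). [this work] -/
def rowLow (A B : Finset (Finset (γ₁ ⊕ Fin 2))) (x : Finset γ₁) : ℤ :=
  rU A x * rU B x + rD A 0 x * rD B 1 x + rD A 1 x * rD B 0 x + (rW A 1 x - rW A 0 x) * (rW B 1 x - rW B 0 x)

/-- **The certificate identity** for one row. [this work] -/
theorem rowLow_eq_cert (A B : Finset (Finset (γ₁ ⊕ Fin 2))) (x : Finset γ₁) :
    rowLow A B x
      = rW A 1 x * rW B 1 x + rV A 1 x * rD B 0 x + rD A 0 x * rV B 1 x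
        + (rU A x - rV A 0 x) * (rU B x - rW B 1 x) + (rU A x - rW A 0 x) * (rU B x - rW B 0 x) + (rU A x - rW A 1 x) * (rU B x - rV B 0 x) := by
  unfold rowLow rU rD rV rW; ring

/-! ### The row decomposition of `score − L` -/

/-- Summing over `refl P₁` is summing over complements. [this work] -/
theorem sum_refl_eq {f : Finset γ₁ → ℤ} (P₁ : Finset (Finset γ₁)) : ∑ x ∈ refl P₁, f x = ∑ x ∈ P₁, f xᶜ := by
  unfold refl; rw [sum_map]; rfl

/-- `{0}ᶜ = {1}` in `Fin 2`. [this work] -/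
theorem compl_zero_fin2 : ({0} : Finset (Fin 2))ᶜ = {1} := by decide

/-- `{1}ᶜ = {0}` in `Fin 2`. [this work] -/
theorem compl_one_fin2 : ({1} : Finset (Fin 2))ᶜ = {0} := by decide

omit [Fintype γ₁] in
/-- The score row: `#(S ∩ B_x ∩ refl A_x) + #(E ∩ A_x ∩ B_x)` as an indicator polynomial. [this work] -/
theorem score_row (A B : Finset (Finset (γ₁ ⊕ Fin 2))) (x : Finset γ₁) :
    (((or2 ∩ refl or2 ∩ secR B x ∩ refl (secR A x)).card : ℤ) + ((or2 \ refl or2) ∩ secR A x ∩ secR B x).card)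
      = ind B (x.disjSum {0}) * ind A (x.disjSum {1}) + ind B (x.disjSum {1}) * ind A (x.disjSum {0})
        + ind A (x.disjSum univ) * ind B (x.disjSum univ) := by
  rw [or2_inter_refl, or2_sdiff_refl, card_pair_inter_inter (by decide), card_singleton_inter_inter, ind_refl, ind_refl,
    compl_zero_fin2, compl_one_fin2, ind_secR, ind_secR, ind_secR, ind_secR, ind_secR, ind_secR]

/-- First `L`-row: `#(or2 ∩ (refl A)_x ∩ B_x)`. [this work] -/
theorem lrow₁ (A B : Finset (Finset (γ₁ ⊕ Fin 2))) (x : Finset γ₁) :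
    ((or2 ∩ secR (refl A) x ∩ secR B x).card : ℤ)
      = ind A (xᶜ.disjSum {1}) * ind B (x.disjSum {0}) + ind A (xᶜ.disjSum {0}) * ind B (x.disjSum {1})
        + ind A (xᶜ.disjSum ∅) * ind B (x.disjSum univ) := by
  rw [or2_eq, card_triple_inter_inter (by decide) (by decide) (by decide), secR_refl, ind_refl, ind_refl, ind_refl,
    compl_zero_fin2, compl_one_fin2, compl_univ, ind_secR, ind_secR, ind_secR, ind_secR, ind_secR, ind_secR]

/-- Second `L`-row: `#(or2 ∩ A_x ∩ (refl B)_x)`. [this work] -/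
theorem lrow₂ (A B : Finset (Finset (γ₁ ⊕ Fin 2))) (x : Finset γ₁) :
    ((or2 ∩ secR A x ∩ secR (refl B) x).card : ℤ)
      = ind A (x.disjSum {0}) * ind B (xᶜ.disjSum {1}) + ind A (x.disjSum {1}) * ind B (xᶜ.disjSum {0})
        + ind A (x.disjSum univ) * ind B (xᶜ.disjSum ∅) := by
  rw [or2_eq, card_triple_inter_inter (by decide) (by decide) (by decide), secR_refl, ind_refl, ind_refl, ind_refl,
    compl_zero_fin2, compl_one_fin2, compl_univ, ind_secR, ind_secR, ind_secR, ind_secR, ind_secR, ind_secR]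

/-- Third `L`-row (antipodal rows): `#(refl or2 ∩ A_{xᶜ} ∩ B_{xᶜ})`. [this work] -/
theorem lrow₃ (A B : Finset (Finset (γ₁ ⊕ Fin 2))) (x : Finset γ₁) :
    ((refl or2 ∩ secR A xᶜ ∩ secR B xᶜ).card : ℤ)
      = ind A (xᶜ.disjSum ∅) * ind B (xᶜ.disjSum ∅) + ind A (xᶜ.disjSum {0}) * ind B (xᶜ.disjSum {0})
        + ind A (xᶜ.disjSum {1}) * ind B (xᶜ.disjSum {1}) := by
  rw [refl_or2, card_triple_inter_inter (by decide) (by decide) (by decide), ind_secR, ind_secR, ind_secR, ind_secR, ind_secR, ind_secR]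

/-- **Row decomposition**: `Σ_B secFAScore − L_{P₁ ∧ or2}(A,B) = Σ_{x∈P₁} rowLow A B x`. [this work] -/
theorem scoreVal_sub_lForm_andProd_or2 (P₁ : Finset (Finset γ₁)) (A B : Finset (Finset (γ₁ ⊕ Fin 2))) :
    scoreVal (secFAScore P₁ or2) A B - lForm (andProd P₁ or2) A B = ∑ x ∈ P₁, rowLow A B x := by
  rw [scoreVal_secFAScore]
  unfold lForm
  rw [card_andProd_inter_inter, card_andProd_inter_inter, refl_andProd, card_andProd_inter_inter, sum_refl_eq]
  rw [← sum_add_distrib, ← sum_sub_distrib, ← sum_sub_distrib]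
  refine sum_congr rfl fun x _ => ?_
  rw [score_row, lrow₁, lrow₂, lrow₃]
  unfold rowLow rU rD rW
  ring

/-! ### The theorem -/

section main
variable {P₁ : Finset (Finset γ₁)} (hP : IsUpperSet (P₁ : Set (Finset γ₁))) (hd : Disjoint P₁ (refl P₁))
  (hcor : ∀ U V : Finset (Finset γ₁), IsUpperSet (U : Set (Finset γ₁)) → IsUpperSet (V : Set (Finset γ₁)) → 0 ≤ corP P₁ U V)
include hP hd hcor

/-- Acuteness for two row atoms of the shape `[x⊔y ∈ A] − [xᶜ⊔y' ∈ A]`, `[x⊔z ∈ B] − [xᶜ⊔z' ∈ B]` (`y' ⊆ y`, `z' ⊆ z`). [this work] -/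
theorem sum_diffInd_mul_nonneg {A B : Finset (Finset (γ₁ ⊕ Fin 2))} (hA : IsUpperSet (A : Set (Finset (γ₁ ⊕ Fin 2))))
    (hB : IsUpperSet (B : Set (Finset (γ₁ ⊕ Fin 2)))) {y y' z z' : Finset (Fin 2)} (hyy : y' ⊆ y) (hzz : z' ⊆ z) :
    0 ≤ ∑ x ∈ P₁, (ind A (x.disjSum y) - ind A (xᶜ.disjSum y')) * (ind B (x.disjSum z) - ind B (xᶜ.disjSum z')) := by
  obtain ⟨bA, mA, pA⟩ := diffInd_facts hA hyy
  obtain ⟨bB, mB, pB⟩ := diffInd_facts hB hzz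
  refine sum_mul_nonneg_of_unit hP hd hcor (fun x => ind A (x.disjSum y) - ind A (xᶜ.disjSum y'))
    (fun x => ind B (x.disjSum z) - ind B (xᶜ.disjSum z')) ?_ ?_ (fun x _ x' _ h => mA x x' h) (fun x _ x' _ h => mB x x' h)
    (fun x _ x' _ h => pA x x' h) (fun x _ x' _ h => pB x x' h)
  · intro x _; have := bA x; omega
  · intro x _; have := bB x; omega

/-- **THEOREM (`AndShellLower` for `Q = or2`).**  For every antipode-free up-set `P₁` with `Cor_{P₁} ≥ 0` on up-set pairs and all up-sets `A, B`:
`L_{P₁ ∧ or2}(A,B) ≤ Σ_B secFAScore P₁ or2`. [this work] -/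
theorem lForm_le_scoreVal_andProd_or2 {A B : Finset (Finset (γ₁ ⊕ Fin 2))} (hA : IsUpperSet (A : Set (Finset (γ₁ ⊕ Fin 2))))
    (hB : IsUpperSet (B : Set (Finset (γ₁ ⊕ Fin 2)))) :
    lForm (andProd P₁ or2) A B ≤ scoreVal (secFAScore P₁ or2) A B := by
  suffices h : 0 ≤ scoreVal (secFAScore P₁ or2) A B - lForm (andProd P₁ or2) A B by linarith
  rw [scoreVal_sub_lForm_andProd_or2, sum_congr rfl fun x _ => rowLow_eq_cert A B x]
  simp only [sum_add_distrib]
  have t1 : 0 ≤ ∑ x ∈ P₁, rW A 1 x * rW B 1 x := sum_diffInd_mul_nonneg hP hd hcor hA hB (subset_univ _) (subset_univ _)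
  have t2 : 0 ≤ ∑ x ∈ P₁, rV A 1 x * rD B 0 x := sum_diffInd_mul_nonneg hP hd hcor hA hB (empty_subset _) Subset.rfl
  have t3 : 0 ≤ ∑ x ∈ P₁, rD A 0 x * rV B 1 x := sum_diffInd_mul_nonneg hP hd hcor hA hB Subset.rfl (empty_subset _)
  have n1 : 0 ≤ ∑ x ∈ P₁, (rU A x - rV A 0 x) * (rU B x - rW B 1 x) := by
    refine sum_nonneg fun x _ => mul_nonneg ?_ ?_
    · unfold rU rV; linarith [ind_mono_pt hA (disjSum_mono (le_refl x) (subset_univ ({0} : Finset (Fin 2))))]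
    · unfold rU rW; linarith [ind_mono_pt hB (disjSum_mono (le_refl xᶜ) (empty_subset ({1} : Finset (Fin 2))))]
  have n2 : 0 ≤ ∑ x ∈ P₁, (rU A x - rW A 0 x) * (rU B x - rW B 0 x) := by
    refine sum_nonneg fun x _ => mul_nonneg ?_ ?_
    · unfold rU rW; linarith [ind_mono_pt hA (disjSum_mono (le_refl xᶜ) (empty_subset ({0} : Finset (Fin 2))))]
    · unfold rU rW; linarith [ind_mono_pt hB (disjSum_mono (le_refl xᶜ) (empty_subset ({0} : Finset (Fin 2))))]
  have n3 : 0 ≤ ∑ x ∈ P₁, (rU A x - rW A 1 x) * (rU B x - rV B 0 x) := by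
    refine sum_nonneg fun x _ => mul_nonneg ?_ ?_
    · unfold rU rW; linarith [ind_mono_pt hA (disjSum_mono (le_refl xᶜ) (empty_subset ({1} : Finset (Fin 2))))]
    · unfold rU rV; linarith [ind_mono_pt hB (disjSum_mono (le_refl x) (subset_univ ({0} : Finset (Fin 2))))]
  linarith

/-- The sectionwise Formula-A score is a score certificate for `P₁ ∧ or2`. [this work] -/
theorem scoreCert_andProd_or2 : ScoreCert (andProd P₁ or2) (secFAScore P₁ or2) := fun _ _ hA hB =>
  ⟨lForm_le_scoreVal_andProd_or2 hP hd hcor hA hB, scoreVal_secFAScore_le_uForm hP isUpperSet_or2 hA hB⟩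

/-- **`TriWIneq` for `P₁ ∧ (x_a ∨ x_b)`** on every index cube, for every intersecting Kleitman shell `P₁`. [this work] -/
theorem triW_nonneg_andProd_or2 (F G : Finset β → Finset (Finset (γ₁ ⊕ Fin 2)))
    (hF : ∀ x, IsUpperSet (F x : Set (Finset (γ₁ ⊕ Fin 2)))) (hG : ∀ x, IsUpperSet (G x : Set (Finset (γ₁ ⊕ Fin 2))))
    (hFm : Monotone F) (hGm : Monotone G) :
    0 ≤ triW (andProd P₁ or2) F G :=
  triW_nonneg_of_scoreCert (monoScore_secFAScore P₁ or2) (scoreCert_andProd_or2 hP hd hcor) F G hF hG hFm hGm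

end main

/-- The same with the hypothesis on `P₁` in Kleitman-shell form. [this work] -/
theorem triW_nonneg_andProd_or2_of_klShell {P₁ : Finset (Finset γ₁)} (hP : IsUpperSet (P₁ : Set (Finset γ₁))) (hd : Disjoint P₁ (refl P₁))
    (hs : KlShell (P₁ ∪ refl P₁)) (F G : Finset β → Finset (Finset (γ₁ ⊕ Fin 2)))
    (hF : ∀ x, IsUpperSet (F x : Set (Finset (γ₁ ⊕ Fin 2)))) (hG : ∀ x, IsUpperSet (G x : Set (Finset (γ₁ ⊕ Fin 2))))
    (hFm : Monotone F) (hGm : Monotone G) :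
    0 ≤ triW (andProd P₁ or2) F G :=
  triW_nonneg_andProd_or2 hP hd (fun U V hU hV => by rw [corP_eq_card_sub_card_of_disjoint hd]; exact hs U V hU hV) F G hF hG hFm hGm

/-- Example: `maj3 ∧ or2` = P5's n = 5 frontier class `(x₀ ∨ x₁)·maj(234)` (up to relabeling). [this work] -/
theorem triW_nonneg_maj3_andProd_or2 (F G : Finset β → Finset (Finset (Fin 3 ⊕ Fin 2)))
    (hF : ∀ x, IsUpperSet (F x : Set (Finset (Fin 3 ⊕ Fin 2)))) (hG : ∀ x, IsUpperSet (G x : Set (Finset (Fin 3 ⊕ Fin 2))))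
    (hFm : Monotone F) (hGm : Monotone G) :
    0 ≤ triW (andProd maj3 or2) F G :=
  triW_nonneg_andProd_or2 isUpperSet_maj3 disjoint_maj3_refl (fun _ _ hU hV => corP_nonneg_of_selfDual maj3_selfDual hU hV) F G hF hG hFm hGm

/-- Example: `(P₁ ∧ maj3) ∧ or2` — the AND theorems compose. [this work] -/
theorem triW_nonneg_andProd_maj3_or2 {P₁ : Finset (Finset γ₁)} (hP : IsUpperSet (P₁ : Set (Finset γ₁))) (hd : Disjoint P₁ (refl P₁))
    (hcor : ∀ U V : Finset (Finset γ₁), IsUpperSet (U : Set (Finset γ₁)) → IsUpperSet (V : Set (Finset γ₁)) → 0 ≤ corP P₁ U V)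
    (F G : Finset β → Finset (Finset ((γ₁ ⊕ Fin 3) ⊕ Fin 2)))
    (hF : ∀ x, IsUpperSet (F x : Set (Finset ((γ₁ ⊕ Fin 3) ⊕ Fin 2)))) (hG : ∀ x, IsUpperSet (G x : Set (Finset ((γ₁ ⊕ Fin 3) ⊕ Fin 2))))
    (hFm : Monotone F) (hGm : Monotone G) :
    0 ≤ triW (andProd (andProd P₁ maj3) or2) F G :=
  triW_nonneg_andProd_or2 (isUpperSet_andProd hP isUpperSet_maj3) (disjoint_andProd_refl hd maj3)
    (fun _ _ hU hV => corP_andProd_maj3_nonneg hP hd hcor hU hV) F G hF hG hFm hGm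

end FiveUpSet

end Summit.CriticalPhenomena.PercolationContinuityZ3.Theorems
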